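import Mathlib
import Literature.MathematicalPhysics.MHD.SolovevFluxSurfaceGGJAverages
import HarnessLib

/-!
# `dV′/dr` and `dq/dr` on the Lee–Cerfon / PCF Solov'ev family by differentiation under the integral,
# and the chain rule to the flux label: the GGJ inputs `V″ = d²V/dΨ²` and `Φ″ = 2π dq/dΨ` (proved)

Sixth file of the `lcLoop` series (gridfusion-model-5). For `Ψ = psiLC κ F_B R₀ q₀ a` [Lee–Cerfon 2015 §4.1
(solo2), bib `LeeCerfon2015`] on the printed loop `lcLoop R₀ κ r` (`u = R₀² + 2rR₀cos t`,
`c = κF_B/(2R₀³q₀)`), the surface functions are explicit parametric integrals in the label `r`: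
`V′(r) = 2π∫₀^{2π} w dt`, `w = κ/(2c√u)` (`volumeDerivE_lcLoop`, Freidberg (6.22) = Jardin (5.29)) and
`q(r) = (q₀R₀³/π)∫₀^π (u√u)⁻¹ dt` (`safetyFactorE_lcLoop`, Freidberg (6.35) = Jardin (5.35)). Jardin's
(8.134) [galaxy:panama:478966162915417 c556000–572000] needs their label-derivatives `V″` and `Φ″`
(`Φ′ = 2πq` in the label `Ψ`, `GradShafranov.toroidalFluxDerivJ_eq`). PROVED here, generically:

* `hasDerivAt_volumeDerivE_lcLoop` — `r ↦ V′` has derivative `2π∫₀^{2π} ∂w/∂r dt`,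
  `∂w/∂r = lcAvgWeightDr = −κR₀cos t/(2c·u√u)`, on every surface `0 < r < R₀/2`, with the derivative
  integrand integrable (dominated differentiation under the integral sign, Mathlib
  `intervalIntegral.hasDerivAt_integral_of_dominated_loc_of_deriv_le`, uniform bound on the label
  neighbourhood `(r/2, (2r+R₀)/4)` where `u > R₀(R₀ − 2r)/2`);
* `hasDerivAt_safetyFactorE_lcLoop` — `r ↦ q` has derivative `(q₀R₀³/π)∫₀^π lcQKernelDr dt`,
  `lcQKernelDr = −3R₀cos t/(u²√u)`;
* `hasDerivAt_lcLabel` — `dΨ_s/dr = 2cR₀²r` (`Ψ_s(r) = cR₀²(r² − a²)`, `psiLC_lcLoop`);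
  `hasDerivAt_lcRadius` — the inverse label map `r(s) = (a² + s/(cR₀²))^{1/2}` has `r(Ψ_s(r)) = r` and
  derivative `1/(2cR₀²r)`; `hasDerivAt_comp_lcRadius` — chain rule: a surface function with `r`-derivative
  `D` has `Ψ`-derivative `D/(2cR₀²r)`; so `V″ = (dV′/dr)/(2cR₀²r)` and `dq/dΨ = (dq/dr)/(2cR₀²r)`,
  `Φ″ = 2π dq/dΨ` — or, since (8.134) admits ANY label, the label `r` may be used directly.

HONEST FRAMING (three columns): exact real analysis about MODEL objects; certified enclosures of the
derivative integrals are a Bench matter; nothing here says anything is stable.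
Typer/prover: gridfusion-model-5 (g3), 2026-08-27.
-/

noncomputable section

namespace Literature.MathematicalPhysics.MHD.Solovev

open GradShafranov FluxGeometry _root_.Real MeasureTheory intervalIntegral _root_.Set _root_.Filter
  _root_.Metric
open scoped _root_.Topology

/-! ## The `r`-derivatives of the two kernels -/

/-- `∂w/∂r = −κR₀cos t/(2c·u√u)`: the `r`-derivative of the density (`∂u/∂r = 2R₀cos t`).
[cite: LeeCerfon2015, §4.1 (boundary parametrisation)] -/
def lcAvgWeightDr (κ FB R₀ q₀ r t : ℝ) : ℝ :=
  -(κ * (R₀ * Real.cos t)) / (2 * (κ * FB / (2 * R₀ ^ 3 * q₀)) * (lcU R₀ r t * Real.sqrt (lcU R₀ r t)))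

/-- `∂/∂r (u√u)⁻¹ = −3R₀cos t/(u²√u)`: the `r`-derivative of the safety-factor kernel of
`safetyFactorE_lcLoop`. [cite: LeeCerfon2015, §4.1 eq. (q4)] -/
def lcQKernelDr (R₀ r t : ℝ) : ℝ :=
  -(3 * (R₀ * Real.cos t)) / (lcU R₀ r t ^ 2 * Real.sqrt (lcU R₀ r t))


/-- `∂u/∂r = 2R₀cos t`. [cite: LeeCerfon2015, §4.1 (boundary parametrisation)] -/
theorem hasDerivAt_lcU_radius (R₀ r t : ℝ) :
    HasDerivAt (fun ρ => lcU R₀ ρ t) (2 * R₀ * Real.cos t) r := by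
  have h := (((hasDerivAt_id' (x := r)).const_mul 2).mul_const (R₀ * Real.cos t)).const_add (R₀ ^ 2)
  have e : (fun ρ : ℝ => R₀ ^ 2 + 2 * ρ * (R₀ * Real.cos t)) = fun ρ => lcU R₀ ρ t := by
    funext ρ; simp only [lcU]; ring
  rw [e] at h
  exact h.congr_deriv (by ring)

/-- `∂w/∂r = lcAvgWeightDr` wherever `u > 0`. [cite: LeeCerfon2015, §4.1 (boundary parametrisation)] -/
theorem hasDerivAt_lcAvgWeight {κ FB R₀ q₀ r t : ℝ} (hκ : 0 < κ) (hFB : 0 < FB) (hR₀ : 0 < R₀)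
    (hq₀ : 0 < q₀) (hu : 0 < lcU R₀ r t) :
    HasDerivAt (fun ρ => lcAvgWeight κ FB R₀ q₀ ρ t) (lcAvgWeightDr κ FB R₀ q₀ r t) r := by
  have hs : 0 < Real.sqrt (lcU R₀ r t) := Real.sqrt_pos.2 hu
  have hc : 0 < κ * FB / (2 * R₀ ^ 3 * q₀) := by positivity
  have h1 := (hasDerivAt_lcU_radius R₀ r t).sqrt hu.ne'
  have h2 : HasDerivAt (fun ρ => 2 * (κ * FB / (2 * R₀ ^ 3 * q₀)) * Real.sqrt (lcU R₀ ρ t))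
      (2 * (κ * FB / (2 * R₀ ^ 3 * q₀)) * (2 * R₀ * Real.cos t / (2 * Real.sqrt (lcU R₀ r t)))) r :=
    h1.const_mul _
  have h3 := (hasDerivAt_const r κ).div h2 (by positivity)
  unfold lcAvgWeight lcAvgWeightDr
  refine h3.congr_deriv ?_
  set s := Real.sqrt (lcU R₀ r t) with hs_def
  have hu' : lcU R₀ r t = s ^ 2 := by rw [hs_def, Real.sq_sqrt hu.le]
  rw [hu']
  field_simp
  ring

/-- `∂/∂r (u√u)⁻¹ = lcQKernelDr` wherever `u > 0`. [cite: LeeCerfon2015, §4.1 eq. (q4)] -/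
theorem hasDerivAt_lcQKernel {R₀ r t : ℝ} (hu : 0 < lcU R₀ r t) :
    HasDerivAt (fun ρ => (lcU R₀ ρ t * Real.sqrt (lcU R₀ ρ t))⁻¹) (lcQKernelDr R₀ r t) r := by
  have hs : 0 < Real.sqrt (lcU R₀ r t) := Real.sqrt_pos.2 hu
  have h1 := hasDerivAt_lcU_radius R₀ r t
  have h2 := h1.mul (h1.sqrt hu.ne')
  have h3 := h2.inv (by simp only [Pi.mul_apply]; positivity)
  unfold lcQKernelDr
  refine h3.congr_deriv ?_
  simp only [Pi.mul_apply]
  set s := Real.sqrt (lcU R₀ r t) with hs_def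
  have hu' : lcU R₀ r t = s ^ 2 := by rw [hs_def, Real.sq_sqrt hu.le]
  rw [hu']
  field_simp
  ring

/-- The neighbourhood used for dominated differentiation: for `0 < r < R₀/2` the open interval
`s = (r/2, (2r + R₀)/4) ∋ r` consists of admissible labels with the UNIFORM bound `u > R₀(R₀ − 2r)/2`.
[folklore] -/
private theorem ggj_nhds {R₀ r : ℝ} (hR₀ : 0 < R₀) (hr : 0 < r) (h2r : 2 * r < R₀) :
    Ioo (r / 2) ((2 * r + R₀) / 4) ∈ 𝓝 r ∧
      ∀ x ∈ Ioo (r / 2) ((2 * r + R₀) / 4),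
        0 < x ∧ 2 * x < R₀ ∧ ∀ t, R₀ * (R₀ - 2 * r) / 2 < lcU R₀ x t := by
  refine ⟨Ioo_mem_nhds (by linarith) (by linarith), fun x hx => ?_⟩
  refine ⟨by linarith [hx.1], by linarith [hx.2], fun t => ?_⟩
  unfold lcU
  have hc := Real.neg_one_le_cos t
  have hx0 : 0 < x := by linarith [hx.1]
  have h1 : 0 ≤ 2 * x * R₀ * (Real.cos t + 1) := mul_nonneg (by positivity) (by linarith)
  have h2 : 2 * x * R₀ < (2 * r + R₀) * R₀ / 2 := by nlinarith [hx.2]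
  linarith

/-- **`dV′/dr` by differentiation under the integral:** on every surface `0 < r < R₀/2` the label-function
`ρ ↦ V′(ρ) = volumeDerivE Ψ (lcLoop R₀ κ ρ) (2π)` (Freidberg (6.22) = Jardin (5.29)) has derivative
`2π ∫₀^{2π} ∂w/∂r dt = 2π∫₀^{2π} −κR₀cos t/(2c·u√u) dt`, and that integrand is integrable.
[cite: Jardin2010, §8.5 eq. (8.134)] -/
theorem hasDerivAt_volumeDerivE_lcLoop {R₀ κ FB q₀ r : ℝ} (hR₀ : 0 < R₀) (hκ : 0 < κ) (hFB : 0 < FB)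
    (hq₀ : 0 < q₀) (hr : 0 < r) (h2r : 2 * r < R₀) (a : ℝ) :
    IntervalIntegrable (lcAvgWeightDr κ FB R₀ q₀ r) volume 0 (2 * π) ∧
    HasDerivAt (fun ρ => volumeDerivE (psiLC κ FB R₀ q₀ a) (lcLoop R₀ κ ρ) (2 * π))
      (2 * π * ∫ t in (0 : ℝ)..(2 * π), lcAvgWeightDr κ FB R₀ q₀ r t) r := by
  obtain ⟨hs, hsub⟩ := ggj_nhds hR₀ hr h2r
  set m : ℝ := R₀ * (R₀ - 2 * r) / 2 with hm_def
  have hm : 0 < m := by rw [hm_def]; nlinarith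
  set c : ℝ := κ * FB / (2 * R₀ ^ 3 * q₀) with hc_def
  have hc : 0 < c := by rw [hc_def]; positivity
  -- continuity of the integrand and of its `r`-derivative in `t`, for admissible labels
  have hcontU : ∀ x, Continuous (fun t => lcU R₀ x t) := fun x => by unfold lcU; fun_prop
  have hcontF : ∀ x, 0 ≤ x → 2 * x < R₀ → Continuous (fun t => lcAvgWeight κ FB R₀ q₀ x t) :=
    fun x hx h2x => continuous_lcAvgWeight hR₀ hκ hFB hq₀ hx h2x
  have hcontF' : ∀ x, 0 ≤ x → 2 * x < R₀ → Continuous (fun t => lcAvgWeightDr κ FB R₀ q₀ x t) := by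
    intro x hx h2x
    have hpos : ∀ t, 0 < lcU R₀ x t := lcU_pos hR₀ hx h2x
    unfold lcAvgWeightDr
    refine Continuous.div (by fun_prop) (continuous_const.mul ((hcontU x).mul (hcontU x).sqrt))
      fun t => ?_
    have := Real.sqrt_pos.2 (hpos t)
    have := hpos t
    positivity
  have key := intervalIntegral.hasDerivAt_integral_of_dominated_loc_of_deriv_le
    (μ := volume) (a := (0 : ℝ)) (b := 2 * π) (F := fun ρ t => lcAvgWeight κ FB R₀ q₀ ρ t)
    (F' := fun ρ t => lcAvgWeightDr κ FB R₀ q₀ ρ t) (x₀ := r)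
    (bound := fun _ => κ * R₀ / (2 * c * (m * Real.sqrt m))) hs
    (Filter.eventually_of_mem hs fun x hx =>
      ((hcontF x (hsub x hx).1.le (hsub x hx).2.1).aestronglyMeasurable).restrict)
    ((hcontF r hr.le h2r).intervalIntegrable _ _)
    ((hcontF' r hr.le h2r).aestronglyMeasurable.restrict)
    (Filter.Eventually.of_forall fun t _ x hx => by
      obtain ⟨hx0, h2x, hux⟩ := hsub x hx
      have hu : m < lcU R₀ x t := hux t
      have hupos : 0 < lcU R₀ x t := lt_trans hm hu
      have hsm : 0 < Real.sqrt m := Real.sqrt_pos.2 hm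
      have hsu : Real.sqrt m ≤ Real.sqrt (lcU R₀ x t) := Real.sqrt_le_sqrt hu.le
      rw [Real.norm_eq_abs]
      unfold lcAvgWeightDr
      rw [← hc_def, abs_div, abs_neg, abs_mul, abs_mul, abs_of_pos hκ, abs_of_pos hR₀,
        abs_of_pos (by positivity : 0 < 2 * c * (lcU R₀ x t * Real.sqrt (lcU R₀ x t)))]
      apply div_le_div₀ (by positivity)
      · exact mul_le_mul_of_nonneg_left (mul_le_of_le_one_right hR₀.le (Real.abs_cos_le_one t))
          hκ.le
      · positivity
      · apply mul_le_mul_of_nonneg_left _ (by positivity)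
        exact mul_le_mul hu.le hsu hsm.le hupos.le)
    intervalIntegrable_const
    (Filter.Eventually.of_forall fun t _ x hx => by
      obtain ⟨hx0, h2x, hux⟩ := hsub x hx
      exact hasDerivAt_lcAvgWeight hκ hFB hR₀ hq₀ (lt_trans hm (hux t)))
  refine ⟨key.1, ?_⟩
  -- transfer from the explicit integral to `volumeDerivE` on the neighbourhood
  have hev : (fun ρ => volumeDerivE (psiLC κ FB R₀ q₀ a) (lcLoop R₀ κ ρ) (2 * π))
      =ᶠ[𝓝 r] fun ρ => 2 * π * ∫ t in (0 : ℝ)..(2 * π), lcAvgWeight κ FB R₀ q₀ ρ t :=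
    Filter.eventually_of_mem hs fun x hx =>
      volumeDerivE_lcLoop_eq hR₀ hκ hFB hq₀ (hsub x hx).1 (hsub x hx).2.1 a
  exact (key.2.const_mul (2 * π)).congr_of_eventuallyEq hev

/-- **`dq/dr` by differentiation under the integral:** on every surface `0 < r < R₀/2` the label-function
`ρ ↦ q(ρ) = safetyFactorE F_B Ψ (lcLoop R₀ κ ρ) (2π)` (Freidberg (6.35) = Jardin (5.35)) has derivative
`(q₀R₀³/π)∫₀^π −3R₀cos t/(u²√u) dt`, and that integrand is integrable. [cite: Jardin2010, §8.5 eq. (8.134)] -/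
theorem hasDerivAt_safetyFactorE_lcLoop {R₀ κ FB q₀ r : ℝ} (hR₀ : 0 < R₀) (hκ : 0 < κ) (hFB : 0 < FB)
    (hq₀ : 0 < q₀) (hr : 0 < r) (h2r : 2 * r < R₀) (a : ℝ) :
    IntervalIntegrable (lcQKernelDr R₀ r) volume 0 π ∧
    HasDerivAt (fun ρ => safetyFactorE FB (psiLC κ FB R₀ q₀ a) (lcLoop R₀ κ ρ) (2 * π))
      (q₀ * R₀ ^ 3 / π * ∫ t in (0 : ℝ)..π, lcQKernelDr R₀ r t) r := by
  obtain ⟨hs, hsub⟩ := ggj_nhds hR₀ hr h2r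
  set m : ℝ := R₀ * (R₀ - 2 * r) / 2 with hm_def
  have hm : 0 < m := by rw [hm_def]; nlinarith
  have hcontU : ∀ x, Continuous (fun t => lcU R₀ x t) := fun x => by unfold lcU; fun_prop
  have hcontF : ∀ x, 0 ≤ x → 2 * x < R₀ →
      Continuous (fun t => (lcU R₀ x t * Real.sqrt (lcU R₀ x t))⁻¹) := by
    intro x hx h2x
    exact ((hcontU x).mul (hcontU x).sqrt).inv₀ fun t =>
      (mul_pos (lcU_pos hR₀ hx h2x t) (Real.sqrt_pos.2 (lcU_pos hR₀ hx h2x t))).ne'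
  have hcontF' : ∀ x, 0 ≤ x → 2 * x < R₀ → Continuous (fun t => lcQKernelDr R₀ x t) := by
    intro x hx h2x
    have hpos : ∀ t, 0 < lcU R₀ x t := lcU_pos hR₀ hx h2x
    unfold lcQKernelDr
    refine Continuous.div (by fun_prop) (((hcontU x).pow 2).mul (hcontU x).sqrt) fun t => ?_
    have := Real.sqrt_pos.2 (hpos t)
    have := hpos t
    positivity
  have key := intervalIntegral.hasDerivAt_integral_of_dominated_loc_of_deriv_le
    (μ := volume) (a := (0 : ℝ)) (b := π) (F := fun ρ t => (lcU R₀ ρ t * Real.sqrt (lcU R₀ ρ t))⁻¹)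
    (F' := fun ρ t => lcQKernelDr R₀ ρ t) (x₀ := r)
    (bound := fun _ => 3 * R₀ / (m ^ 2 * Real.sqrt m)) hs
    (Filter.eventually_of_mem hs fun x hx =>
      ((hcontF x (hsub x hx).1.le (hsub x hx).2.1).aestronglyMeasurable).restrict)
    ((hcontF r hr.le h2r).intervalIntegrable _ _)
    ((hcontF' r hr.le h2r).aestronglyMeasurable.restrict)
    (Filter.Eventually.of_forall fun t _ x hx => by
      obtain ⟨hx0, h2x, hux⟩ := hsub x hx
      have hu : m < lcU R₀ x t := hux t
      have hupos : 0 < lcU R₀ x t := lt_trans hm hu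
      have hsm : 0 < Real.sqrt m := Real.sqrt_pos.2 hm
      have hsu : Real.sqrt m ≤ Real.sqrt (lcU R₀ x t) := Real.sqrt_le_sqrt hu.le
      rw [Real.norm_eq_abs]
      unfold lcQKernelDr
      rw [abs_div, abs_neg, abs_mul, abs_mul, abs_of_pos hR₀, abs_of_pos (by norm_num : (0 : ℝ) < 3),
        abs_of_pos (by positivity : 0 < lcU R₀ x t ^ 2 * Real.sqrt (lcU R₀ x t))]
      apply div_le_div₀ (by positivity)
      · exact mul_le_mul_of_nonneg_left (mul_le_of_le_one_right hR₀.le (Real.abs_cos_le_one t))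
          (by norm_num)
      · positivity
      · exact mul_le_mul (pow_le_pow_left₀ hm.le hu.le 2) hsu hsm.le (by positivity))
    intervalIntegrable_const
    (Filter.Eventually.of_forall fun t _ x hx => by
      obtain ⟨hx0, h2x, hux⟩ := hsub x hx
      exact hasDerivAt_lcQKernel (lt_trans hm (hux t)))
  refine ⟨key.1, ?_⟩
  have hev : (fun ρ => safetyFactorE FB (psiLC κ FB R₀ q₀ a) (lcLoop R₀ κ ρ) (2 * π))
      =ᶠ[𝓝 r] fun ρ => q₀ * R₀ ^ 3 / π
        * ∫ t in (0 : ℝ)..π, (lcU R₀ ρ t * Real.sqrt (lcU R₀ ρ t))⁻¹ :=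
    Filter.eventually_of_mem hs fun x hx =>
      safetyFactorE_lcLoop hR₀ hκ hFB hq₀ (hsub x hx).1 (hsub x hx).2.1 a
  exact (key.2.const_mul (q₀ * R₀ ^ 3 / π)).congr_of_eventuallyEq hev

/-! ## From the label `r` to the label `Ψ`: `dΨ_s/dr = 2cR₀²r` and the chain rule -/

/-- `dΨ_s/dr = 2cR₀²r` for the surface value `Ψ_s(r) = cR₀²(r² − a²)` (`psiLC_lcLoop`).
[cite: LeeCerfon2015, §4.1] -/
theorem hasDerivAt_lcLabel (κ FB R₀ q₀ a r : ℝ) :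
    HasDerivAt (fun ρ => κ * FB / (2 * R₀ ^ 3 * q₀) * (R₀ ^ 2 * (ρ ^ 2 - a ^ 2)))
      (2 * (κ * FB / (2 * R₀ ^ 3 * q₀)) * R₀ ^ 2 * r) r := by
  have h := (((hasDerivAt_pow 2 r).sub_const (a ^ 2)).const_mul (R₀ ^ 2)).const_mul
    (κ * FB / (2 * R₀ ^ 3 * q₀))
  exact h.congr_deriv (by norm_num; ring)

/-- The inverse label map `r(s) = (a² + s/(cR₀²))^{1/2}` (so `r(Ψ_s(r)) = r`) has derivative
`1/(2cR₀²r)` at `s = Ψ_s(r)`, `r > 0`, `c ≠ 0`, `R₀ ≠ 0`. [cite: LeeCerfon2015, §4.1] -/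
theorem hasDerivAt_lcRadius {κ FB R₀ q₀ a r : ℝ} (hc : κ * FB / (2 * R₀ ^ 3 * q₀) ≠ 0) (hR₀ : R₀ ≠ 0)
    (hr : 0 < r) :
    Real.sqrt (a ^ 2 + κ * FB / (2 * R₀ ^ 3 * q₀) * (R₀ ^ 2 * (r ^ 2 - a ^ 2))
        / (κ * FB / (2 * R₀ ^ 3 * q₀) * R₀ ^ 2)) = r ∧
    HasDerivAt (fun s => Real.sqrt (a ^ 2 + s / (κ * FB / (2 * R₀ ^ 3 * q₀) * R₀ ^ 2)))
      (1 / (2 * (κ * FB / (2 * R₀ ^ 3 * q₀)) * R₀ ^ 2 * r))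
      (κ * FB / (2 * R₀ ^ 3 * q₀) * (R₀ ^ 2 * (r ^ 2 - a ^ 2))) := by
  set c := κ * FB / (2 * R₀ ^ 3 * q₀) with hc_def
  have hcR : c * R₀ ^ 2 ≠ 0 := mul_ne_zero hc (pow_ne_zero 2 hR₀)
  have hin : a ^ 2 + c * (R₀ ^ 2 * (r ^ 2 - a ^ 2)) / (c * R₀ ^ 2) = r ^ 2 := by
    field_simp; ring
  have hval : Real.sqrt (a ^ 2 + c * (R₀ ^ 2 * (r ^ 2 - a ^ 2)) / (c * R₀ ^ 2)) = r := by
    rw [hin, Real.sqrt_sq hr.le]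
  refine ⟨hval, ?_⟩
  have h1 : HasDerivAt (fun s => a ^ 2 + s / (c * R₀ ^ 2)) (1 / (c * R₀ ^ 2))
      (c * (R₀ ^ 2 * (r ^ 2 - a ^ 2))) :=
    ((hasDerivAt_id' (x := c * (R₀ ^ 2 * (r ^ 2 - a ^ 2)))).div_const (c * R₀ ^ 2)).const_add (a ^ 2)
  have h2 := h1.sqrt (by rw [hin]; positivity)
  refine h2.congr_deriv ?_
  rw [hval]
  field_simp

/-- **Chain rule to the label `Ψ`:** if a surface function has `r`-derivative `D` at `r > 0`, then as a
function of the flux label `s = Ψ_s` (through `r(s) = (a² + s/(cR₀²))^{1/2}`) it has derivative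
`D/(2cR₀²r)` at `s = Ψ_s(r)`. Applied to `hasDerivAt_volumeDerivE_lcLoop` this is `V″ = d²V/dΨ²`;
applied to `hasDerivAt_safetyFactorE_lcLoop` it is `dq/dΨ`, and `Φ″ = 2π dq/dΨ`
(`GradShafranov.toroidalFluxDerivJ_eq`). [cite: Jardin2010, §8.5 eq. (8.134)] -/
theorem hasDerivAt_comp_lcRadius {κ FB R₀ q₀ a r D : ℝ} {Φ : ℝ → ℝ}
    (hc : κ * FB / (2 * R₀ ^ 3 * q₀) ≠ 0) (hR₀ : R₀ ≠ 0) (hr : 0 < r) (hΦ : HasDerivAt Φ D r) :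
    HasDerivAt (fun s => Φ (Real.sqrt (a ^ 2 + s / (κ * FB / (2 * R₀ ^ 3 * q₀) * R₀ ^ 2))))
      (D / (2 * (κ * FB / (2 * R₀ ^ 3 * q₀)) * R₀ ^ 2 * r))
      (κ * FB / (2 * R₀ ^ 3 * q₀) * (R₀ ^ 2 * (r ^ 2 - a ^ 2))) := by
  obtain ⟨hval, hrad⟩ := hasDerivAt_lcRadius (a := a) hc hR₀ hr
  have h := hΦ.comp_of_eq _ hrad hval.symm
  refine h.congr_deriv ?_
  ring

end Literature.MathematicalPhysics.MHD.Solovev
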